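import Summits.CriticalPhenomena.PercolationContinuityZ3.Theorems.PercNearOneGluingNoHeavyLowerTailSahiGridPatternAllDim

/-!
# `NoHeavyLowerTail` (crux stmt-CriticalPhenomena-4575), Sahi programme P1: **THE PATTERN FUNCTIONAL ON ORTHANT TRIPLES FACTORISES
# OVER THE AXES** — a closed form for `sStarD (↑u) (↑v) (↑w)` in EVERY dimension, and inclusion–exclusion in each slot

Support file (Sahi cell, seat `prim-sahi-p1`, generation 18; `--supports stmt-CriticalPhenomena-4575`).  Pure proofs, NO definitions, no `sorry`,
standard axioms.  Vocabulary of `…SahiGridPattern` / `…SahiGridPatternAllDim` (`Pd`, `col`, `sStarD`, `tcD`, `sum_pi_boole_all`).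

THE MATHEMATICS.  For thresholds `u, v, w ∈ [3]^d` write `↑u = {x : u ≤ x}` (an orthant = principal up-set; in the tree
`univ.filter fun x => ∀ a, u a ≤ x a`, as in `sStarD_principal_nonneg`).  The indicator of an orthant at a pattern point `col π c = (a ↦ π_a c)`
is a conjunction over the axes, so each of the five terms of the three-copy kernel summed over `π ∈ S₃^d` is a PRODUCT over the axes of
one-axis counts (sums over `σ ∈ S₃`):
  `sStarD ↑u ↑v ↑w = 2·∏_a #{σ : u_a,v_a,w_a ≤ σ0} − ∏_a #{σ : u_a ≤ σ0; v_a,w_a ≤ σ1} − ∏_a #{σ : v_a ≤ σ0; u_a,w_a ≤ σ1}`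
  `                  − ∏_a #{σ : w_a ≤ σ0; u_a,v_a ≤ σ1} + ∏_a #{σ : u_a ≤ σ0, v_a ≤ σ1, w_a ≤ σ2}`            (**`sStarD_orthant_eq_prod`**),
with the one-axis counts in closed form `2(3 − max)`, `(3−i)(3−m) − (3 − max(i,m))` (`m = max` of the two second-point thresholds) and the
Latin count (`orthCount_diag/pair/latin`, by `decide`).  Together with INCLUSION–EXCLUSION IN A SLOT (`sStarD_union_add_inter₁/₂/₃`, from the
trilinear form `sStarD_eq_sum_tcD`) and `↑u ∩ ↑v = ↑(u ⊔ v)` (`orthant_inter`), the pattern functional of ANY triple of unions of orthants in ANY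
dimension is an explicit signed sum of products of one-axis counts — the closed form behind generation 18's exact census of few-generator
triples in unbounded dimension (memo `FROM-prim-sahi-p1-gen18-…`): e.g. for `a, b, c` equal to `2` on three disjoint blocks of `m` axes each,
`sStarD (↑b ∪ ↑c) (↑a ∪ ↑c) (↑a ∪ ↑b) = 2^{3m}` exactly (relative margin `→ 0`), the `[3]^d` form of the Boolean `N = 1` tight families.
Nothing here asserts `PatternPos d` for any `d ≥ 4`. [this work]
-/

namespace Summit.CriticalPhenomena.PercolationContinuityZ3.Theorems.SahiGridPattern

open Finset SahiGrid3
open scoped BigOperators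

variable {d : ℕ}

/-! ### Orthants: indicator, intersection -/

/-- Indicator of the orthant `↑u` at `x` is the axiswise condition `∀ a, u a ≤ x a`. [this work] -/
theorem ind_orthant (u x : Pd d) :
    ind (univ.filter fun y : Pd d => ∀ a, u a ≤ y a) x = if (∀ a, u a ≤ x a) then 1 else 0 := by
  unfold ind; simp only [mem_filter, mem_univ, true_and]

/-- `↑u ∩ ↑v = ↑(u ⊔ v)`. [this work] -/
theorem orthant_inter (u v : Pd d) :
    (univ.filter fun x : Pd d => ∀ a, u a ≤ x a) ∩ (univ.filter fun x : Pd d => ∀ a, v a ≤ x a) =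
      univ.filter fun x : Pd d => ∀ a, (u ⊔ v) a ≤ x a := by
  ext x
  simp only [mem_inter, mem_filter, mem_univ, true_and, Pi.sup_apply, sup_le_iff]
  exact ⟨fun h a => ⟨h.1 a, h.2 a⟩, fun h => ⟨fun a => (h a).1, fun a => (h a).2⟩⟩

/-- The orthant of the zero threshold is the whole cube. [this work] -/
theorem orthant_zero : (univ.filter fun x : Pd d => ∀ a, (0 : Pd d) a ≤ x a) = univ := by
  ext x; simp only [mem_filter, mem_univ, true_and, iff_true]; exact fun a => Fin.zero_le _

/-! ### Inclusion–exclusion in each slot (from the trilinear form) -/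

/-- **Inclusion–exclusion in the first slot**: `S(X ∪ Y, B, C) + S(X ∩ Y, B, C) = S(X,B,C) + S(Y,B,C)` (any finsets). [this work] -/
theorem sStarD_union_add_inter₁ (X Y B C : Finset (Pd d)) :
    sStarD (X ∪ Y) B C + sStarD (X ∩ Y) B C = sStarD X B C + sStarD Y B C := by
  simp only [sStarD_eq_sum_tcD]
  exact Finset.sum_union_inter

/-- Inclusion–exclusion in the second slot. [this work] -/
theorem sStarD_union_add_inter₂ (A X Y C : Finset (Pd d)) :
    sStarD A (X ∪ Y) C + sStarD A (X ∩ Y) C = sStarD A X C + sStarD A Y C := by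
  simp only [sStarD_eq_sum_tcD, ← Finset.sum_add_distrib]
  exact Finset.sum_congr rfl fun p _ => Finset.sum_union_inter

/-- Inclusion–exclusion in the third slot. [this work] -/
theorem sStarD_union_add_inter₃ (A B X Y : Finset (Pd d)) :
    sStarD A B (X ∪ Y) + sStarD A B (X ∩ Y) = sStarD A B X + sStarD A B Y := by
  simp only [sStarD_eq_sum_tcD, ← Finset.sum_add_distrib]
  exact Finset.sum_congr rfl fun p _ => Finset.sum_congr rfl fun q _ => Finset.sum_union_inter

/-! ### The factorisation over the axes -/

/-- A triple product of orthant conditions at pattern points is one axiswise condition. [this work] -/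
theorem ite3_le_all (π : Fin d → Equiv.Perm (Fin 3)) (i j k : Fin 3) (u v w : Pd d) :
    ((if (∀ a, u a ≤ col π i a) then (1:ℤ) else 0) * (if (∀ a, v a ≤ col π j a) then 1 else 0) *
        (if (∀ a, w a ≤ col π k a) then 1 else 0)) =
      if (∀ a, u a ≤ π a i ∧ v a ≤ π a j ∧ w a ≤ π a k) then 1 else 0 := by
  by_cases h : (∀ a, u a ≤ π a i ∧ v a ≤ π a j ∧ w a ≤ π a k)
  · have h1 : ∀ a, u a ≤ col π i a := fun a => (h a).1
    have h2 : ∀ a, v a ≤ col π j a := fun a => (h a).2.1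
    have h3 : ∀ a, w a ≤ col π k a := fun a => (h a).2.2
    rw [if_pos h1, if_pos h2, if_pos h3, if_pos h]; rfl
  · rw [if_neg h]
    by_cases h1 : (∀ a, u a ≤ col π i a)
    · by_cases h2 : (∀ a, v a ≤ col π j a)
      · have h3 : ¬ (∀ a, w a ≤ col π k a) := fun h3 => h fun a => ⟨h1 a, h2 a, h3 a⟩
        rw [if_neg h3, mul_zero]
      · rw [if_neg h2, mul_zero, zero_mul]
    · rw [if_neg h1, zero_mul, zero_mul]

/-- **THE PATTERN FUNCTIONAL OF AN ORTHANT TRIPLE FACTORISES OVER THE AXES** (every dimension): each of the five terms of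
`sStarD ↑u ↑v ↑w` is a product over the axes of a one-axis count over `S₃`. [this work] -/
theorem sStarD_orthant_eq_prod (u v w : Pd d) :
    sStarD (univ.filter fun x : Pd d => ∀ a, u a ≤ x a) (univ.filter fun x : Pd d => ∀ a, v a ≤ x a)
        (univ.filter fun x : Pd d => ∀ a, w a ≤ x a) =
      2 * ∏ a, (∑ σ : Equiv.Perm (Fin 3), if (u a ≤ σ 0 ∧ v a ≤ σ 0 ∧ w a ≤ σ 0) then (1:ℤ) else 0)
      - ∏ a, (∑ σ : Equiv.Perm (Fin 3), if (u a ≤ σ 0 ∧ v a ≤ σ 1 ∧ w a ≤ σ 1) then (1:ℤ) else 0)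
      - ∏ a, (∑ σ : Equiv.Perm (Fin 3), if (v a ≤ σ 0 ∧ u a ≤ σ 1 ∧ w a ≤ σ 1) then (1:ℤ) else 0)
      - ∏ a, (∑ σ : Equiv.Perm (Fin 3), if (w a ≤ σ 0 ∧ u a ≤ σ 1 ∧ v a ≤ σ 1) then (1:ℤ) else 0)
      + ∏ a, (∑ σ : Equiv.Perm (Fin 3), if (u a ≤ σ 0 ∧ v a ≤ σ 1 ∧ w a ≤ σ 2) then (1:ℤ) else 0) := by
  unfold sStarD hZ
  simp only [ind_orthant]
  simp only [Finset.sum_add_distrib, Finset.sum_sub_distrib, ite3_le_all]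
  have t1 : (∑ π : Fin d → Equiv.Perm (Fin 3), (2:ℤ) * if (∀ a, u a ≤ π a 0 ∧ v a ≤ π a 0 ∧ w a ≤ π a 0) then 1 else 0)
      = 2 * ∏ a, (∑ σ : Equiv.Perm (Fin 3), if (u a ≤ σ 0 ∧ v a ≤ σ 0 ∧ w a ≤ σ 0) then (1:ℤ) else 0) := by
    rw [← Finset.mul_sum, sum_pi_boole_all (fun a σ => u a ≤ σ 0 ∧ v a ≤ σ 0 ∧ w a ≤ σ 0)]
  have t2 : (∑ π : Fin d → Equiv.Perm (Fin 3), if (∀ a, u a ≤ π a 0 ∧ v a ≤ π a 1 ∧ w a ≤ π a 1) then (1:ℤ) else 0)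
      = ∏ a, (∑ σ : Equiv.Perm (Fin 3), if (u a ≤ σ 0 ∧ v a ≤ σ 1 ∧ w a ≤ σ 1) then (1:ℤ) else 0) :=
    sum_pi_boole_all (fun a σ => u a ≤ σ 0 ∧ v a ≤ σ 1 ∧ w a ≤ σ 1)
  have t3 : (∑ π : Fin d → Equiv.Perm (Fin 3), if (∀ a, v a ≤ π a 0 ∧ u a ≤ π a 1 ∧ w a ≤ π a 1) then (1:ℤ) else 0)
      = ∏ a, (∑ σ : Equiv.Perm (Fin 3), if (v a ≤ σ 0 ∧ u a ≤ σ 1 ∧ w a ≤ σ 1) then (1:ℤ) else 0) :=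
    sum_pi_boole_all (fun a σ => v a ≤ σ 0 ∧ u a ≤ σ 1 ∧ w a ≤ σ 1)
  have t4 : (∑ π : Fin d → Equiv.Perm (Fin 3), if (∀ a, w a ≤ π a 0 ∧ u a ≤ π a 1 ∧ v a ≤ π a 1) then (1:ℤ) else 0)
      = ∏ a, (∑ σ : Equiv.Perm (Fin 3), if (w a ≤ σ 0 ∧ u a ≤ σ 1 ∧ v a ≤ σ 1) then (1:ℤ) else 0) :=
    sum_pi_boole_all (fun a σ => w a ≤ σ 0 ∧ u a ≤ σ 1 ∧ v a ≤ σ 1)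
  have t5 : (∑ π : Fin d → Equiv.Perm (Fin 3), if (∀ a, u a ≤ π a 0 ∧ v a ≤ π a 1 ∧ w a ≤ π a 2) then (1:ℤ) else 0)
      = ∏ a, (∑ σ : Equiv.Perm (Fin 3), if (u a ≤ σ 0 ∧ v a ≤ σ 1 ∧ w a ≤ σ 2) then (1:ℤ) else 0) :=
    sum_pi_boole_all (fun a σ => u a ≤ σ 0 ∧ v a ≤ σ 1 ∧ w a ≤ σ 2)
  rw [t1, t2, t3, t4, t5]

/-! ### The one-axis counts in closed form (`decide` over `S₃ × [3]³`) -/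

/-- Diagonal one-axis count: `#{σ ∈ S₃ : i, j, k ≤ σ0} = 2·(3 − max(i,j,k))`. [this work] -/
theorem orthCount_diag (i j k : Fin 3) :
    (∑ σ : Equiv.Perm (Fin 3), if (i ≤ σ 0 ∧ j ≤ σ 0 ∧ k ≤ σ 0) then (1:ℤ) else 0) =
      2 * (3 - ((max (max i j) k : Fin 3) : ℤ)) := by
  rw [sum_perm_eq_permList]; revert i j k; decide

/-- Pair one-axis count: `#{σ ∈ S₃ : i ≤ σ0; j, k ≤ σ1} = (3 − i)(3 − m) − (3 − max(i,m))`, `m = max(j,k)` (ordered pairs of distinct values). [this work] -/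
theorem orthCount_pair (i j k : Fin 3) :
    (∑ σ : Equiv.Perm (Fin 3), if (i ≤ σ 0 ∧ j ≤ σ 1 ∧ k ≤ σ 1) then (1:ℤ) else 0) =
      (3 - (i : ℤ)) * (3 - ((max j k : Fin 3) : ℤ)) - (3 - ((max i (max j k) : Fin 3) : ℤ)) := by
  rw [sum_perm_eq_permList]; revert i j k; decide

/-- Latin one-axis count: `#{σ ∈ S₃ : i ≤ σ0, j ≤ σ1, k ≤ σ2}` as an explicit function of the sorted thresholds is not needed; we record
the values used by the census: it is `6, 4, 2, 2, 1, 0` at `(i,j,k) = (0,0,0), (1,0,0), (1,1,0), (2,0,0), (2,1,0), (1,1,1)` (and symmetric). [this work] -/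
theorem orthCount_latin_values :
    (∑ σ : Equiv.Perm (Fin 3), if ((0:Fin 3) ≤ σ 0 ∧ (0:Fin 3) ≤ σ 1 ∧ (0:Fin 3) ≤ σ 2) then (1:ℤ) else 0) = 6 ∧
    (∑ σ : Equiv.Perm (Fin 3), if ((1:Fin 3) ≤ σ 0 ∧ (0:Fin 3) ≤ σ 1 ∧ (0:Fin 3) ≤ σ 2) then (1:ℤ) else 0) = 4 ∧
    (∑ σ : Equiv.Perm (Fin 3), if ((1:Fin 3) ≤ σ 0 ∧ (1:Fin 3) ≤ σ 1 ∧ (0:Fin 3) ≤ σ 2) then (1:ℤ) else 0) = 2 ∧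
    (∑ σ : Equiv.Perm (Fin 3), if ((2:Fin 3) ≤ σ 0 ∧ (0:Fin 3) ≤ σ 1 ∧ (0:Fin 3) ≤ σ 2) then (1:ℤ) else 0) = 2 ∧
    (∑ σ : Equiv.Perm (Fin 3), if ((2:Fin 3) ≤ σ 0 ∧ (1:Fin 3) ≤ σ 1 ∧ (0:Fin 3) ≤ σ 2) then (1:ℤ) else 0) = 1 ∧
    (∑ σ : Equiv.Perm (Fin 3), if ((1:Fin 3) ≤ σ 0 ∧ (1:Fin 3) ≤ σ 1 ∧ (1:Fin 3) ≤ σ 2) then (1:ℤ) else 0) = 0 := by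
  simp only [sum_perm_eq_permList]; decide

/-! ### First consequences -/

/-- **The whole cube in all three slots**: `sStarD ⊤ ⊤ ⊤ = 0` in every dimension (`2·6^d − 3·6^d + 6^d`). [this work] -/
theorem sStarD_univ_univ_univ : sStarD (univ : Finset (Pd d)) univ univ = 0 := by
  have h := sStarD_orthant_eq_prod (d := d) 0 0 0
  rw [orthant_zero] at h
  rw [h]
  have e6 : ∀ (P : Equiv.Perm (Fin 3) → Prop) [DecidablePred P], (∀ σ, P σ) →
      (∑ σ : Equiv.Perm (Fin 3), if P σ then (1:ℤ) else 0) = 6 := by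
    intro P _ hP
    rw [Finset.sum_congr rfl fun σ _ => if_pos (hP σ)]
    simp only [Finset.sum_const, Finset.card_univ, Fintype.card_perm, Fintype.card_fin, nsmul_eq_mul, mul_one]
    rfl
  simp only [Pi.zero_apply, Fin.zero_le, and_self]
  rw [e6 (fun _ => True) (fun _ => trivial)]
  simp only [Finset.prod_const, Finset.card_univ, Fintype.card_fin]
  ring

end Summit.CriticalPhenomena.PercolationContinuityZ3.Theorems.SahiGridPattern
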